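import Summits.BirchSwinnertonDyer.BirchSwinnertonDyer.Theorems.ClassRecordThreeEulerHalvesAtThreeCartanTransportResiduePinning
import Summits.BirchSwinnertonDyer.BirchSwinnertonDyer.Theorems.ClassRecordThreeEulerHalvesAtThreeCartanTransportNormOneLift
import Summits.BirchSwinnertonDyer.BirchSwinnertonDyer.Theorems.ClassRecordThreeEulerHalvesAtThreeCartanTransportTheta
import Summits.BirchSwinnertonDyer.BirchSwinnertonDyer.Theorems.ClassRecordThreeEulerHalvesAtThreeCartanTransportHull
import Summits.BirchSwinnertonDyer.BirchSwinnertonDyer.Theorems.ClassRecordThreeEulerHalvesAtThreeResidualUpperBoundCartanEmptyDegreeIndep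
import HarnessLib

/-!
# Cartan transport, brick A2 — two Cartan data of the same level are `GL₂⁺(ℝ)`-conjugate; presentation independence of the
class-minimal degree at a GENERAL Cartan level `(D, M; C)`

Helper file for the crux `EulerHalvesAtThree` of route `ClassRecordThree` (node served: the residue crux
`EulerHalvesAtThreeResidualUpperBound`, line `cartan`, item NUM := `CartanOnePlaceDegreeLawAtThree`), completing road HT of the
workfile `Cruxes/EulerHalvesAtThree/TRANSPORT-HULL.md`: the clause «the data `Q`, `Q'` being ARBITRARY presentations is absorbed by
type number one» of the stub (F2b♮) is now a theorem at every Cartan level, not only at `C = ∅` (tree `CartanDegree.CartanEmptyDegreeIndep`,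
`stub_cartanEmptyDegreeIndep`).

THEOREM (`exists_gl_conj_of_hull`, the transport). Let `X₁ X₂ : CartanLevelCurveData D M C` and let `g₀ ∈ GL₂(ℝ)` conjugate the
HULLS: `ι₂(X₂.O₀) = g₀ ι₁(X₁.O₀) g₀⁻¹`. Then some `g` with `det g = det g₀` conjugates the CARTAN ORDERS: `ι₂(X₂.O) = g ι₁(X₁.O) g⁻¹`.
PROOF (all ingredients are landed bricks of this directory). `Θ := ι₂⁻¹ ∘ Ad(g₀) ∘ ι₁` is a ring isomorphism `X₁.O₀ → X₂.O₀`
(brick A1, `Theta.exists_theta`); fix residue models `ψ_q : X₂.O₀ → M₂(𝔽_q)` at `q ∈ C` (brick H1) and the transported models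
`ψ_q ∘ Θ` of `X₁.O₀` (A1). By brick H2b both Cartan orders are cut out of their hulls by residue conditions at the primes of `C` with
residue FIELDS `𝔽_q[η₂,q]`, `𝔽_q[η₁,q]` (`ResiduePinning.exists_eta`, `mem_O_iff_residues`). Brick F conjugates `𝔽_q[η₁,q]` onto
`𝔽_q[η₂,q]` by some `w_q ∈ SL₂(𝔽_q)`; brick S (strong approximation for the norm-one group) lifts `(w_q)_{q odd}` up to sign to ONE
`u ∈ X₂.O₀` of reduced norm `1`; at `q = 2` no prescription is needed because `M₂(𝔽₂)` has a single copy of `𝔽₄` (A1,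
`Two.conj_mem_field_iff_two`). Then `y ↦ u y u⁻¹` carries `X₂.O` onto `Θ(X₁.O)` residue condition by residue condition, i.e.
`g := ι₂(u)⁻¹ g₀` works, and `det ι₂(u) = nrd u = 1`.

COROLLARIES. `exists_gl_pos_conj_cartan`: any two Cartan data of level `(D, M; C)` are `GL₂⁺(ℝ)`-conjugate (hull level: tree
`CartanDegree.exists_gl_pos_conj` on the hull Shimura data of brick H0, Eichler's principal-ideal theorem
`ShimuraCurveData.exists_eq_units_smul_of_pos` supplying its hypothesis exactly as in `stub_cartanEmptyDegreeIndep`).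
`cartanDegreeIndep`: the class-minimal modular degree over `X_{(D,M;C)}` does not depend on the presenting datum — transport of
parametrisation data along `τ ↦ g τ` (tree `CartanDegree.exists_cartanParametrizationData_deg_eq`, already typed at general `C`) and
class-minimality on both sides; its `C = ∅` instance is the tree's `stub_cartanEmptyDegreeIndep` (not restated).

What this file does NOT do: it proves no crux, stub or summit statement; (F2b♮) ⟺ NUM stays open (its content is the one-place
degree law, not the transport). [cite: VignerasLNM800, Ch. III §4 Thm. 4.3 (strong approximation, norm-one group), §5 Cor. 5.7
(type number of Eichler orders), Ch. I §2 Thm. 2.1 (Skolem–Noether)] [cite: Voight2021, Thm. 28.5.3, Cor. 28.5.9]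
-/

set_option linter.dupNamespace false
set_option autoImplicit false

open scoped MatrixGroups

namespace Summit.BirchSwinnertonDyer.BirchSwinnertonDyer.Theorems.CartanTransport.Conj

open Literature.NumberTheory.Automorphic
open Summit.BirchSwinnertonDyer.BirchSwinnertonDyer.Theorems.CartanDegree
open Summit.BirchSwinnertonDyer.BirchSwinnertonDyer.Theorems.CartanTorusCubeCut
open Summit.BirchSwinnertonDyer.BirchSwinnertonDyer.Theorems.CartanTransport

variable {D M : ℕ} {C : Finset ℕ}

/-! ## §1 Residue bookkeeping for a pair of mutually inverse hull elements -/

/-- For `ψ` multiplicative and unital on `O₀` and `u v ∈ O₀` with `u v = 1 = v u`: `ψ v ψ u = 1` and `ψ u ψ v = 1`. [folklore] -/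
theorem map_inv_pair {B : Type*} [Ring B] {O : Submodule ℤ B} {p : ℕ} {F : Type*} [Field F]
    {ψ : B → Matrix (Fin 2) (Fin 2) F} (h : IsMatrixResidueMap O p ψ) {u v : B} (hu : u ∈ O) (hv : v ∈ O)
    (huv : u * v = 1) (hvu : v * u = 1) : ψ v * ψ u = 1 ∧ ψ u * ψ v = 1 := by
  constructor
  · rw [← h.map_mul v hv u hu, hvu, h.map_one]
  · rw [← h.map_mul u hu v hv, huv, h.map_one]

/-- If `ψ u = ± w` for a unit `w` and `ψ v ψ u = 1`, then conjugation by the pair `(ψ v, ψ u)` is conjugation by `(w⁻¹, w)`. [folklore] -/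
theorem conj_pair_eq {F : Type*} [Field F] {a b : Matrix (Fin 2) (Fin 2) F} (w : GL (Fin 2) F)
    (hab : a * b = 1) (hb : b = (w : Matrix (Fin 2) (Fin 2) F) ∨ b = -(w : Matrix (Fin 2) (Fin 2) F))
    (L : Matrix (Fin 2) (Fin 2) F) :
    a * L * b = ((w⁻¹ : GL (Fin 2) F) : Matrix (Fin 2) (Fin 2) F) * L * (w : Matrix (Fin 2) (Fin 2) F) ∧
      b * L * a = (w : Matrix (Fin 2) (Fin 2) F) * L * ((w⁻¹ : GL (Fin 2) F) : Matrix (Fin 2) (Fin 2) F) := by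
  rcases hb with rfl | rfl
  · have ha : a = ((w⁻¹ : GL (Fin 2) F) : Matrix (Fin 2) (Fin 2) F) := by
      calc a = a * ((w : Matrix (Fin 2) (Fin 2) F) * ((w⁻¹ : GL (Fin 2) F) : Matrix (Fin 2) (Fin 2) F)) := by
            rw [Units.mul_inv, mul_one]
        _ = ((w⁻¹ : GL (Fin 2) F) : Matrix (Fin 2) (Fin 2) F) := by rw [← mul_assoc, hab, one_mul]
    rw [ha]
    exact ⟨rfl, rfl⟩
  · have hab' : a * (w : Matrix (Fin 2) (Fin 2) F) = -1 := by
      rw [mul_neg] at hab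
      exact (neg_eq_iff_eq_neg.mp hab)
    have ha : a = -((w⁻¹ : GL (Fin 2) F) : Matrix (Fin 2) (Fin 2) F) := by
      calc a = a * (w : Matrix (Fin 2) (Fin 2) F) * ((w⁻¹ : GL (Fin 2) F) : Matrix (Fin 2) (Fin 2) F) := by
            rw [mul_assoc, Units.mul_inv, mul_one]
        _ = -((w⁻¹ : GL (Fin 2) F) : Matrix (Fin 2) (Fin 2) F) := by rw [hab', neg_one_mul]
    rw [ha, neg_mul, neg_mul, mul_neg, neg_neg, neg_mul, neg_mul, mul_neg, neg_neg]
    exact ⟨rfl, rfl⟩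

/-! ## §2 The transport: conjugate hulls ⇒ conjugate Cartan orders -/

/-- PROVED — **THE TRANSPORT.** For two Cartan data `X₁ X₂ : CartanLevelCurveData D M C` whose hulls are conjugate,
`ι₂(X₂.O₀) = g₀ ι₁(X₁.O₀) g₀⁻¹`, there is `g ∈ GL₂(ℝ)` with `det g = det g₀` and `ι₂(X₂.O) = g ι₁(X₁.O) g⁻¹`; in fact `g = ι₂(u)⁻¹ g₀`
for a unit `u ∈ X₂.O₀` of reduced norm `1` (bricks A1, H1, H2b, F, S; see the module docstring).
[cite: VignerasLNM800, Ch. III §4 Thm. 4.3, §5 Cor. 5.7] -/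
theorem exists_gl_conj_of_hull (X₁ X₂ : CartanLevelCurveData D M C) (g₀ : GL (Fin 2) ℝ)
    (H₀ : ∀ m : Matrix (Fin 2) (Fin 2) ℝ, (∃ x ∈ X₁.O₀, X₁.ι x = m) ↔
      ∃ y ∈ X₂.O₀, X₂.ι y = (g₀ : Matrix (Fin 2) (Fin 2) ℝ) * m * ((g₀⁻¹ : GL (Fin 2) ℝ) : Matrix (Fin 2) (Fin 2) ℝ)) :
    ∃ g : GL (Fin 2) ℝ, Matrix.GeneralLinearGroup.det g = Matrix.GeneralLinearGroup.det g₀ ∧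
      ∀ m : Matrix (Fin 2) (Fin 2) ℝ, (∃ x ∈ X₁.O, X₁.ι x = m) ↔
        ∃ y ∈ X₂.O, X₂.ι y = (g : Matrix (Fin 2) (Fin 2) ℝ) * m * ((g⁻¹ : GL (Fin 2) ℝ) : Matrix (Fin 2) (Fin 2) ℝ) := by
  classical
  have hO₁ : Brandt.IsOrder X₁.B X₁.O₀ := X₁.isEichlerOrder.isOrder
  have hO₂ : Brandt.IsOrder X₂.B X₂.O₀ := X₂.isEichlerOrder.isOrder
  -- (A1) the order isomorphism `Θ : X₁.O₀ → X₂.O₀` under `Ad g₀`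
  obtain ⟨Θ, hΘO, hΘι, hadd, hmul, hone, hsmul, hsurj, hinj⟩ := Theta.exists_theta X₁ X₂ g₀ H₀
  -- (H1) residue models of `X₂.O₀` at the primes of `C`, and (A1) the transported models of `X₁.O₀`
  have hψex : ∀ q : ℕ, ∃ ψ : X₂.B → Matrix (Fin 2) (Fin 2) (ZMod q), ∀ hq : q ∈ C,
      haveI : Fact q.Prime := ⟨(X₂.coprime q hq).1⟩; IsMatrixResidueMap X₂.O₀ q ψ := by
    intro q
    by_cases hq : q ∈ C
    · haveI : Fact q.Prime := ⟨(X₂.coprime q hq).1⟩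
      obtain ⟨ψ, hψ⟩ := Residue.exists_isMatrixResidueMap_of_mem X₂ hq
      exact ⟨ψ, fun _ => hψ⟩
    · exact ⟨fun _ => 0, fun h => (hq h).elim⟩
  choose ψ hψ using hψex
  have hψΘ : ∀ (q : ℕ) (hq : q ∈ C), haveI : Fact q.Prime := ⟨(X₁.coprime q hq).1⟩;
      IsMatrixResidueMap X₁.O₀ q (fun x => ψ q (Θ x)) := fun q hq => by
    haveI : Fact q.Prime := ⟨(X₁.coprime q hq).1⟩
    exact Theta.isMatrixResidueMap_comp X₁ X₂ hΘO hadd hmul hone hsmul hsurj hinj (hψ q hq)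
  -- (H2b) the residue fields pinning `X₂.O` and `X₁.O` inside their hulls
  have hη₂ex : ∀ q : ℕ, ∃ η : Matrix (Fin 2) (Fin 2) (ZMod q), ∀ hq : q ∈ C, ¬ HasRatEigenvalue η ∧
      ∀ y ∈ X₂.O₀, ((∃ a ∈ X₂.O, ∃ z ∈ X₂.O₀, y - a = (q : ℤ) • z) ↔
        ∃ c : ZMod q × ZMod q, ψ q y = c.1 • (1 : Matrix (Fin 2) (Fin 2) (ZMod q)) + c.2 • η) := by
    intro q
    by_cases hq : q ∈ C
    · haveI : Fact q.Prime := ⟨(X₂.coprime q hq).1⟩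
      obtain ⟨η, hη, hT⟩ := ResiduePinning.exists_eta X₂ hq (hψ q hq)
      exact ⟨η, fun _ => ⟨hη, fun y hy => ResiduePinning.mem_level_iff_exists_lin X₂ (hψ q hq) hT hy⟩⟩
    · exact ⟨0, fun h => (hq h).elim⟩
  choose η₂ hη₂ using hη₂ex
  have hη₁ex : ∀ q : ℕ, ∃ η : Matrix (Fin 2) (Fin 2) (ZMod q), ∀ hq : q ∈ C, ¬ HasRatEigenvalue η ∧
      ∀ x ∈ X₁.O₀, ((∃ a ∈ X₁.O, ∃ z ∈ X₁.O₀, x - a = (q : ℤ) • z) ↔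
        ∃ c : ZMod q × ZMod q, ψ q (Θ x) = c.1 • (1 : Matrix (Fin 2) (Fin 2) (ZMod q)) + c.2 • η) := by
    intro q
    by_cases hq : q ∈ C
    · haveI : Fact q.Prime := ⟨(X₁.coprime q hq).1⟩
      obtain ⟨η, hη, hT⟩ := ResiduePinning.exists_eta X₁ hq (hψΘ q hq)
      exact ⟨η, fun _ => ⟨hη, fun x hx => ResiduePinning.mem_level_iff_exists_lin X₁ (hψΘ q hq) hT hx⟩⟩
    · exact ⟨0, fun h => (hq h).elim⟩
  choose η₁ hη₁ using hη₁ex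
  have hpin₂ : ∀ y : X₂.B, y ∈ X₂.O ↔ y ∈ X₂.O₀ ∧ ∀ q ∈ C, ∃ c : ZMod q × ZMod q,
      ψ q y = c.1 • (1 : Matrix (Fin 2) (Fin 2) (ZMod q)) + c.2 • η₂ q :=
    ResiduePinning.mem_O_iff_residues X₂ ψ η₂ fun q hq y hy => (hη₂ q hq).2 y hy
  have hpin₁ : ∀ x : X₁.B, x ∈ X₁.O ↔ x ∈ X₁.O₀ ∧ ∀ q ∈ C, ∃ c : ZMod q × ZMod q,
      ψ q (Θ x) = c.1 • (1 : Matrix (Fin 2) (Fin 2) (ZMod q)) + c.2 • η₁ q :=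
    ResiduePinning.mem_O_iff_residues X₁ (fun q x => ψ q (Θ x)) η₁ fun q hq x hx => (hη₁ q hq).2 x hx
  -- (F) a determinant-one conjugator of the residue fields at each `q ∈ C`
  have hwex : ∀ q : ℕ, ∃ w : GL (Fin 2) (ZMod q), ∀ hq : q ∈ C,
      (w : Matrix (Fin 2) (Fin 2) (ZMod q)).det = 1 ∧
      (∀ c : ZMod q × ZMod q, ∃ c' : ZMod q × ZMod q,
        ((w⁻¹ : GL (Fin 2) (ZMod q)) : Matrix (Fin 2) (Fin 2) (ZMod q)) *
            (c.1 • (1 : Matrix (Fin 2) (Fin 2) (ZMod q)) + c.2 • η₁ q) * (w : Matrix (Fin 2) (Fin 2) (ZMod q)) =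
          c'.1 • (1 : Matrix (Fin 2) (Fin 2) (ZMod q)) + c'.2 • η₂ q) ∧
      (∀ c' : ZMod q × ZMod q, ∃ c : ZMod q × ZMod q,
        (w : Matrix (Fin 2) (Fin 2) (ZMod q)) * (c'.1 • (1 : Matrix (Fin 2) (Fin 2) (ZMod q)) + c'.2 • η₂ q) *
            ((w⁻¹ : GL (Fin 2) (ZMod q)) : Matrix (Fin 2) (Fin 2) (ZMod q)) =
          c.1 • (1 : Matrix (Fin 2) (Fin 2) (ZMod q)) + c.2 • η₁ q) := by
    intro q
    by_cases hq : q ∈ C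
    · haveI : Fact q.Prime := ⟨(X₂.coprime q hq).1⟩
      obtain ⟨y, hdet, hfwd, hbwd⟩ := ResidueField.exists_det_one_conj_field (hη₂ q hq).1 (hη₁ q hq).1
      exact ⟨y, fun _ => ⟨hdet, hfwd, hbwd⟩⟩
    · exact ⟨1, fun h => (hq h).elim⟩
  choose w hw using hwex
  -- (S) a norm-one hull element with the prescribed odd residues, and its inverse in the hull
  obtain ⟨u, huO, hnu, hures⟩ := NormOneLift.exists_normOne_residues X₂ ψ hψ
    (fun q => (w q : Matrix (Fin 2) (Fin 2) (ZMod q))) fun q hq _ => (hw q hq).1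
  obtain ⟨v, hvO, huv, hvu⟩ := (hO₂.exists_inv_mem_iff huO).mpr (Or.inl hnu)
  -- residue conjugations by `(ψ v, ψ u)`
  have hres : ∀ (q : ℕ) (hq : q ∈ C) (L : Matrix (Fin 2) (Fin 2) (ZMod q)),
      ((∃ c : ZMod q × ZMod q, L = c.1 • (1 : Matrix (Fin 2) (Fin 2) (ZMod q)) + c.2 • η₁ q) →
        ∃ c' : ZMod q × ZMod q, ψ q v * L * ψ q u = c'.1 • (1 : Matrix (Fin 2) (Fin 2) (ZMod q)) + c'.2 • η₂ q) ∧
      ((∃ c' : ZMod q × ZMod q, L = c'.1 • (1 : Matrix (Fin 2) (Fin 2) (ZMod q)) + c'.2 • η₂ q) →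
        ∃ c : ZMod q × ZMod q, ψ q u * L * ψ q v = c.1 • (1 : Matrix (Fin 2) (Fin 2) (ZMod q)) + c.2 • η₁ q) := by
    intro q hq L
    haveI : Fact q.Prime := ⟨(X₂.coprime q hq).1⟩
    obtain ⟨h1vu, h1uv⟩ := map_inv_pair (hψ q hq) huO hvO huv hvu
    by_cases hq2 : q = 2
    · subst hq2
      let z : GL (Fin 2) (ZMod 2) := ⟨ψ 2 u, ψ 2 v, h1uv, h1vu⟩
      let z' : GL (Fin 2) (ZMod 2) := ⟨ψ 2 v, ψ 2 u, h1vu, h1uv⟩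
      constructor
      · rintro ⟨c, rfl⟩
        exact (Two.conj_mem_field_iff_two (hη₂ 2 hq).1 (hη₁ 2 hq).1 z _).mp ⟨c, rfl⟩
      · rintro ⟨c', rfl⟩
        exact (Two.conj_mem_field_iff_two (hη₁ 2 hq).1 (hη₂ 2 hq).1 z' _).mp ⟨c', rfl⟩
    · obtain ⟨e₁, e₂⟩ := conj_pair_eq (w q) h1vu (hures q hq hq2) L
      constructor
      · rintro ⟨c, rfl⟩
        obtain ⟨c', hc'⟩ := (hw q hq).2.1 c
        exact ⟨c', by rw [e₁]; exact hc'⟩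
      · rintro ⟨c', rfl⟩
        obtain ⟨c, hc⟩ := (hw q hq).2.2 c'
        exact ⟨c, by rw [e₂]; exact hc⟩
  -- the unit `U := ι₂(u)` and the conjugator `g := U⁻¹ g₀`
  let uU : (X₂.B)ˣ := ⟨u, v, huv, hvu⟩
  let U : GL (Fin 2) ℝ := Units.map (X₂.ι : X₂.B →* Matrix (Fin 2) (Fin 2) ℝ) uU
  have hιu : X₂.ι u = (U : Matrix (Fin 2) (Fin 2) ℝ) := by rw [Units.coe_map, MonoidHom.coe_coe]
  have hιv : X₂.ι v = ((U⁻¹ : GL (Fin 2) ℝ) : Matrix (Fin 2) (Fin 2) ℝ) := by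
    rw [← map_inv, Units.coe_map, MonoidHom.coe_coe]
    rfl
  have hdetU : Matrix.GeneralLinearGroup.det U = 1 := Units.ext (by
    rw [Matrix.GeneralLinearGroup.val_det_apply, ← hιu, AlgHom.det_eq_reducedNorm, hnu, map_one, Units.val_one])
  refine ⟨U⁻¹ * g₀, by rw [map_mul, map_inv, hdetU, inv_one, one_mul], fun m => ?_⟩
  rw [mul_inv_rev, inv_inv, Units.val_mul, Units.val_mul]
  constructor
  · rintro ⟨x, hx, rfl⟩
    have hx₀ : x ∈ X₁.O₀ := X₁.le hx
    refine ⟨v * Θ x * u, (hpin₂ _).mpr ⟨hO₂.mul_mem _ (hO₂.mul_mem _ hvO _ (hΘO x hx₀)) _ huO, fun q hq => ?_⟩, ?_⟩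
    · haveI : Fact q.Prime := ⟨(X₂.coprime q hq).1⟩
      rw [(hψ q hq).map_mul _ (hO₂.mul_mem _ hvO _ (hΘO x hx₀)) _ huO, (hψ q hq).map_mul _ hvO _ (hΘO x hx₀)]
      exact (hres q hq _).1 (((hpin₁ x).mp hx).2 q hq)
    · rw [map_mul, map_mul, hΘι x hx₀, hιu, hιv]
      simp only [mul_assoc]
  · rintro ⟨y, hy, hyι⟩
    have hy₀ : y ∈ X₂.O₀ := X₂.le hy
    obtain ⟨x, hx₀, hΘx⟩ := hsurj (u * y * v) (hO₂.mul_mem _ (hO₂.mul_mem _ huO _ hy₀) _ hvO)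
    refine ⟨x, (hpin₁ x).mpr ⟨hx₀, fun q hq => ?_⟩, ?_⟩
    · haveI : Fact q.Prime := ⟨(X₂.coprime q hq).1⟩
      rw [hΘx, (hψ q hq).map_mul _ (hO₂.mul_mem _ huO _ hy₀) _ hvO, (hψ q hq).map_mul _ huO _ hy₀]
      exact (hres q hq _).2 (((hpin₂ y).mp hy).2 q hq)
    · apply Theta.conj_injective g₀
      rw [← hΘι x hx₀, hΘx, map_mul, map_mul, hyι, hιu, hιv]
      simp only [← mul_assoc, Units.mul_inv, one_mul, Units.mul_inv_cancel_right]

/-! ## §3 Any two Cartan data of one level are `GL₂⁺(ℝ)`-conjugate; presentation independence of the class-minimal degree -/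

/-- PROVED — **two Cartan data of level `(D, M; C)` are `GL₂⁺(ℝ)`-conjugate**: `ι₂(X₂.O) = g ι₁(X₁.O) g⁻¹` with `det g > 0`
(hulls: Hasse–Brauer–Noether, type number one, Skolem–Noether and Eichler's norm theorem — tree `exists_gl_pos_conj` on the hull
Shimura data of brick H0, its ideal-theoretic hypothesis discharged by `ShimuraCurveData.exists_eq_units_smul_of_pos`; then the
transport `exists_gl_conj_of_hull`). [cite: VignerasLNM800, Ch. III §5 Cor. 5.7, §4 Thm. 4.3, Ch. I §2 Thm. 2.1] -/
theorem exists_gl_pos_conj_cartan (X₁ X₂ : CartanLevelCurveData D M C) :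
    ∃ g : GL (Fin 2) ℝ, 0 < (Matrix.GeneralLinearGroup.det g).val ∧
      ∀ m : Matrix (Fin 2) (Fin 2) ℝ, (∃ x ∈ X₁.O, X₁.ι x = m) ↔
        ∃ y ∈ X₂.O, X₂.ι y = (g : Matrix (Fin 2) (Fin 2) ℝ) * m * ((g⁻¹ : GL (Fin 2) ℝ) : Matrix (Fin 2) (Fin 2) ℝ) := by
  obtain ⟨fd₁, hfd₁⟩ := Hull.exists_isHypFundamentalDomain_hull X₁
  obtain ⟨fd₂, hfd₂⟩ := Hull.exists_isHypFundamentalDomain_hull X₂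
  obtain ⟨g₀, hg₀, H₀⟩ := exists_gl_pos_conj (X₁.toShimuraCurveData fd₁ hfd₁) (X₂.toShimuraCurveData fd₂ hfd₂)
    fun hD X _ hI hIO => X.exists_eq_units_smul_of_pos hD (Hull.level_pos X₁) hI hIO
  obtain ⟨g, hdet, H⟩ := exists_gl_conj_of_hull X₁ X₂ g₀ H₀
  exact ⟨g, by rw [hdet]; exact hg₀, H⟩

/-- PROVED — **presentation independence of the class-minimal degree at a general Cartan level `(D, M; C)`**: for Cartan data
`X₁ X₂ : CartanLevelCurveData D M C` and class-minimal parametrisation data `Q₁` over `X₁`, `Q₂` over `X₂` of curves in the isogeny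
class of `V`, `Q₁.deg = Q₂.deg`. (`exists_gl_pos_conj_cartan` + transport of parametrisation data along `τ ↦ g τ`, tree
`exists_cartanParametrizationData_deg_eq`, in both directions + class-minimality. The `C = ∅` case is the tree's
`stub_cartanEmptyDegreeIndep`.) [cite: VignerasLNM800, Ch. III §5 Cor. 5.7] -/
theorem cartanDegreeIndep (V : WeierstrassCurve ℚ) (X₁ : CartanLevelCurveData D M C) (W₁ : WeierstrassCurve ℚ)
    [W₁.IsElliptic] (Q₁ : CartanParametrizationData X₁ W₁) (X₂ : CartanLevelCurveData D M C) (W₂ : WeierstrassCurve ℚ)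
    [W₂.IsElliptic] (Q₂ : CartanParametrizationData X₂ W₂) (h₁ : Q₁.IsMinimalFor V) (h₂ : Q₂.IsMinimalFor V) :
    Q₁.deg = Q₂.deg := by
  obtain ⟨g, hg, H⟩ := exists_gl_pos_conj_cartan X₁ X₂
  have hg' : 0 < (Matrix.GeneralLinearGroup.det g⁻¹).val := by
    rw [map_inv, Units.val_inv_eq_inv_val]
    exact inv_pos.mpr hg
  obtain ⟨Q₂', h₂'⟩ := exists_cartanParametrizationData_deg_eq X₁ X₂ H hg Q₂
  obtain ⟨Q₁', h₁'⟩ := exists_cartanParametrizationData_deg_eq X₂ X₁ (conjRel_symm H) hg' Q₁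
  refine le_antisymm ?_ ?_
  · rw [← h₂']
    exact h₁.2 W₂ Q₂' h₂.1
  · rw [← h₁']
    exact h₂.2 W₁ Q₁' h₁.1

end Summit.BirchSwinnertonDyer.BirchSwinnertonDyer.Theorems.CartanTransport.Conj
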